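import Summits.Ventures.WeilGRH.TwistedModulatedFlatTest
import Summits.Ventures.WeilGRH.TwistedFlatTestBounds
import Literature.NumberTheory.LFunctions.WeilArchDensityMoments
import Literature.Analysis.SpecialFunctions.DigammaVerticalSeries
import Mathlib.Analysis.SpecialFunctions.ImproperIntegrals
import HarnessLib

/-!
# GRH arm (rh-explicit, venture WeilGRH): the archimedean cost of modulation IS the digamma weight

Cell `rh-explicit`, WEIL TRACK (structure seat weil-3, gen7).  In `TwistedModulatedFlatTest.lean` the modulated
flat window `e^{iτx}χ_0` pays the archimedean cost `∫₀^∞ ρ_κ(t)·2(1 − cos τt) dt`.  For the even density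
`ρ₀(t) = e^{t/2}/(2 sinh t) = Σ_{m≥0} e^{−(2m+½)t}` this cost is EXACTLY the digamma weight of the explicit
formula (`integral_weilArchDensity_modulationCost`):

  `∫₀^∞ ρ₀(t)·2(1 − cos τt) dt = Re ψ(¼ + iτ/2) − ψ(¼)`

(termwise Laplace transforms `∫₀^∞ e^{−lt}·2(1 − cos τt) dt = 2τ²/(l(l² + τ²))` = the terms of the vertical series
`Literature.Analysis.SpecialFunctions.hasSum_digammaTerm`, Andrews–Askey–Roy (1.2.13); the remainder of the finite
exponential split `weilArchDensity_eq_sum_add_rem` is `≤ 4/l_M + τ²/l_M² → 0`).  Hence the even-parity modulated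
flat-window inequality in digamma form (`modulatedFlatWindow_le_log_digamma_of_even`):

  `WeilPositivityOnChar χ a (χ even, q ≠ 1) ⟹ 2Σ_{log n<2a}Λ(n)n^{-1/2}(1 − log n/(2a))Re(χ(n)n^{iτ})`
      `≤ log q − K₀ + [Re ψ(¼ + iτ/2) − ψ(¼)] − (1/a)∫₀^∞ρ₀(t)cos(τt)min(t,2a)dt`   for every `τ ∈ ℝ`

— the rung makes the Fejér-smoothed KEY WEIGHT `Re ψ(¼ + iτ/2) + log q − …` non-negative at every height
(numerically `K₀ + ψ(¼) = log π`).  No definitions, no named facts.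
-/

set_option autoImplicit false

noncomputable section

open Complex Filter Set MeasureTheory
open scoped Real Topology ComplexConjugate ArithmeticFunction.vonMangoldt

namespace Summit.Ventures.WeilGRH

open Literature.NumberTheory.LFunctions
open Literature.Analysis.SpecialFunctions (reDigammaQuarter digammaTerm digammaNode hasSum_digammaTerm
  digammaNode_pos)

/-! ## Laplace transform of `2(1 − cos τt)` -/

/-- `∫₀^∞ e^{−lt} dt = 1/l` (`l > 0`). -/
private theorem integral_real_exp_neg_mul_Ioi {l : ℝ} (hl : 0 < l) :
    ∫ t in Ioi (0 : ℝ), Real.exp (-(l * t)) = 1 / l := by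
  have h := integral_exp_mul_Ioi (a := -l) (by linarith) 0
  simp only [mul_zero, Real.exp_zero, neg_mul] at h
  rw [h]; field_simp

/-- `∫₀^∞ e^{−lt} cos(τt) dt = l/(l² + τ²)` (`l > 0`; real part of `∫₀^∞ e^{(−l+iτ)t} dt = 1/(l − iτ)`). -/
theorem integral_exp_neg_mul_cos_Ioi {l : ℝ} (hl : 0 < l) (τ : ℝ) :
    ∫ t in Ioi (0 : ℝ), Real.exp (-(l * t)) * Real.cos (τ * t) = l / (l ^ 2 + τ ^ 2) := by
  set a : ℂ := -(l : ℂ) + τ * I with ha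
  have hare : a.re = -l := by simp [ha]
  have ha0 : a.re < 0 := by rw [hare]; linarith
  have hint := integrableOn_exp_mul_complex_Ioi ha0 0
  have hI := integral_exp_mul_complex_Ioi ha0 0
  have hpt : ∀ t : ℝ, (cexp (a * t)).re = Real.exp (-(l * t)) * Real.cos (τ * t) := by
    intro t
    rw [Complex.exp_re]
    congr 1
    · simp [ha]
    · simp [ha]
  rw [← integral_congr_ae (Eventually.of_forall fun t ↦ hpt t)]
  change ∫ t in Ioi (0:ℝ), RCLike.re (cexp (a * t)) = _
  rw [integral_re hint, hI]
  simp only [Complex.ofReal_zero, mul_zero, Complex.exp_zero]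
  have hne : a ≠ 0 := fun h ↦ by rw [h] at hare; simp at hare; linarith
  have hnorm : Complex.normSq a = l ^ 2 + τ ^ 2 := by rw [Complex.normSq_apply]; simp [ha]; ring
  rw [show (-(1:ℂ) / a) = -(a⁻¹) by ring, RCLike.re_to_complex, Complex.neg_re, Complex.inv_re, hnorm, hare]
  field_simp

/-- `t ↦ e^{−lt}·2(1 − cos τt)` is integrable on `(0, ∞)` (`l > 0`). -/
theorem integrableOn_exp_neg_mul_modulation {l : ℝ} (hl : 0 < l) (τ : ℝ) :
    IntegrableOn (fun t : ℝ ↦ Real.exp (-(l * t)) * (2 * (1 - Real.cos (τ * t)))) (Ioi 0) := by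
  have h1 : IntegrableOn (fun t : ℝ ↦ Real.exp (-l * t)) (Ioi 0) := exp_neg_integrableOn_Ioi 0 hl
  refine Integrable.mono' (h1.const_mul 4) ?_ ?_
  · exact ((by fun_prop : Continuous fun t : ℝ ↦ Real.exp (-(l * t)) * (2 * (1 - Real.cos (τ * t)))).measurable
      |>.aestronglyMeasurable)
  · refine (ae_restrict_iff' measurableSet_Ioi).2 (Eventually.of_forall fun t _ ↦ ?_)
    rw [Real.norm_eq_abs, abs_mul, abs_of_pos (Real.exp_pos _), neg_mul]
    have hc := Real.abs_cos_le_one (τ * t)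
    have : |2 * (1 - Real.cos (τ * t))| ≤ 4 := by
      rw [abs_le]; constructor <;> nlinarith [abs_le.1 hc]
    nlinarith [Real.exp_pos (-(l * t))]

/-- **`∫₀^∞ e^{−lt}·2(1 − cos τt) dt = 2τ²/(l(l² + τ²)) = digammaTerm l τ`** (`l > 0`). -/
theorem integral_exp_neg_mul_modulation {l : ℝ} (hl : 0 < l) (τ : ℝ) :
    ∫ t in Ioi (0 : ℝ), Real.exp (-(l * t)) * (2 * (1 - Real.cos (τ * t))) = digammaTerm l τ := by
  have h1 : IntegrableOn (fun t : ℝ ↦ Real.exp (-(l * t))) (Ioi 0) := by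
    have := exp_neg_integrableOn_Ioi 0 hl
    exact this.congr_fun (fun t _ ↦ by simp only [neg_mul]) measurableSet_Ioi
  have h2 : IntegrableOn (fun t : ℝ ↦ Real.exp (-(l * t)) * Real.cos (τ * t)) (Ioi 0) := by
    refine Integrable.mono' h1 ((by fun_prop : Continuous fun t : ℝ ↦
      Real.exp (-(l * t)) * Real.cos (τ * t)).measurable.aestronglyMeasurable) ?_
    refine Eventually.of_forall fun t ↦ ?_
    rw [Real.norm_eq_abs, abs_mul, abs_of_pos (Real.exp_pos _)]
    exact mul_le_of_le_one_right (Real.exp_pos _).le (Real.abs_cos_le_one _)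
  have hsplit : (fun t : ℝ ↦ Real.exp (-(l * t)) * (2 * (1 - Real.cos (τ * t)))) =
      fun t ↦ 2 * Real.exp (-(l * t)) - 2 * (Real.exp (-(l * t)) * Real.cos (τ * t)) := by
    funext t; ring
  rw [hsplit, integral_sub (h1.const_mul 2) (h2.const_mul 2), integral_const_mul, integral_const_mul,
    integral_real_exp_neg_mul_Ioi hl, integral_exp_neg_mul_cos_Ioi hl, digammaTerm]
  have hl2 : l ^ 2 + τ ^ 2 ≠ 0 := by positivity
  field_simp
  ring

/-- The parity-`0` density is `ρ₀ = weilArchDensity`. -/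
theorem weilArchDensityPar_zero_apply (t : ℝ) : weilArchDensityPar 0 t = weilArchDensity t := by
  rw [weilArchDensityPar, weilArchDensity]
  congr 2
  push_cast
  ring

/-! ## The cost of modulation -/

/-- `2(1 − cos x) ≤ x²`. -/
private theorem two_mul_one_sub_cos_le_sq (x : ℝ) : 2 * (1 - Real.cos x) ≤ x ^ 2 := by
  have := Real.one_sub_sq_div_two_le_cos (x := x)
  linarith

/-- `0 ≤ 2(1 − cos x) ≤ 4`. -/
theorem two_mul_one_sub_cos_mem (x : ℝ) : 0 ≤ 2 * (1 - Real.cos x) ∧ 2 * (1 - Real.cos x) ≤ 4 := by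
  have h1 := Real.cos_le_one x
  have h2 := Real.neg_one_le_cos x
  constructor <;> linarith

/-- The modulation integrand `ρ₀(t)·2(1 − cos τt)` is integrable on `(0, ∞)`
(`≤ τ²·t·(tρ₀) ≤ τ² t e^{−t/2}(1 + 2t)/2`). -/
theorem integrableOn_weilArchDensity_modulation (τ : ℝ) :
    IntegrableOn (fun t : ℝ ↦ weilArchDensity t * (2 * (1 - Real.cos (τ * t)))) (Ioi 0) := by
  -- majorant `τ² · t · e^{-t/2}(1+2t)/2 = τ²/2 · (t e^{-t/2} + 2 t² e^{-t/2})`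
  have hG2 := Real.integral_rpow_mul_exp_neg_mul_Ioi (a := 2) (r := 1 / 2) two_pos (by norm_num)
  have hG3 := Real.integral_rpow_mul_exp_neg_mul_Ioi (a := 3) (r := 1 / 2) (by norm_num) (by norm_num)
  have hi2 : IntegrableOn (fun t : ℝ ↦ t ^ ((2:ℝ) - 1) * Real.exp (-(1 / 2 * t))) (Ioi 0) :=
    Integrable.of_integral_ne_zero (by rw [hG2]; positivity)
  have hi3 : IntegrableOn (fun t : ℝ ↦ t ^ ((3:ℝ) - 1) * Real.exp (-(1 / 2 * t))) (Ioi 0) :=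
    Integrable.of_integral_ne_zero (by rw [hG3]; positivity)
  have hmaj : IntegrableOn (fun t : ℝ ↦ τ ^ 2 / 2 * (t ^ ((2:ℝ) - 1) * Real.exp (-(1 / 2 * t)) +
      2 * (t ^ ((3:ℝ) - 1) * Real.exp (-(1 / 2 * t))))) (Ioi 0) := (hi2.add (hi3.const_mul 2)).const_mul _
  refine Integrable.mono' hmaj ?_ ?_
  · exact (measurable_weilArchDensityPar 0 |>.mul (by fun_prop : Continuous fun t : ℝ ↦
      2 * (1 - Real.cos (τ * t))).measurable).aestronglyMeasurable.congr
      (Eventually.of_forall fun t ↦ by simp only [Pi.mul_apply, weilArchDensityPar_zero_apply])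
  · refine (ae_restrict_iff' measurableSet_Ioi).2 (Eventually.of_forall fun t (ht : 0 < t) ↦ ?_)
    have hρ := (weilArchDensity_pos ht).le
    obtain ⟨hc0, hc4⟩ := two_mul_one_sub_cos_mem (τ * t)
    rw [Real.norm_of_nonneg (mul_nonneg hρ hc0), show (2:ℝ) - 1 = 1 by norm_num,
      show (3:ℝ) - 1 = 2 by norm_num, Real.rpow_one, Real.rpow_two]
    have hcos : 2 * (1 - Real.cos (τ * t)) ≤ τ ^ 2 * t ^ 2 := by
      have := two_mul_one_sub_cos_le_sq (τ * t); nlinarith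
    have htρ := mul_weilArchDensity_le ht
    calc weilArchDensity t * (2 * (1 - Real.cos (τ * t))) ≤ weilArchDensity t * (τ ^ 2 * t ^ 2) :=
          mul_le_mul_of_nonneg_left hcos hρ
      _ = τ ^ 2 * t * (t * weilArchDensity t) := by ring
      _ ≤ τ ^ 2 * t * (Real.exp (-(1 / 2 * t)) * (1 + 2 * t) / 2) :=
          mul_le_mul_of_nonneg_left htρ (by positivity)
      _ = τ ^ 2 / 2 * (t * Real.exp (-(1 / 2 * t)) + 2 * (t ^ 2 * Real.exp (-(1 / 2 * t)))) := by ring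

/-- **THE ARCHIMEDEAN COST OF MODULATION IS THE DIGAMMA WEIGHT**:
`∫₀^∞ ρ₀(t)·2(1 − cos τt) dt = Re ψ(¼ + iτ/2) − Re ψ(¼)` for every real `τ`
(`ρ₀(t) = e^{t/2}/(2 sinh t) = weilArchDensity t`). -/
theorem integral_weilArchDensity_modulationCost (τ : ℝ) :
    ∫ t in Ioi (0 : ℝ), weilArchDensity t * (2 * (1 - Real.cos (τ * t))) =
      reDigammaQuarter τ - reDigammaQuarter 0 := by
  set J : ℝ := ∫ t in Ioi (0 : ℝ), weilArchDensity t * (2 * (1 - Real.cos (τ * t))) with hJ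
  -- partial sums of the digamma series tend to the series' value …
  have hser := (hasSum_digammaTerm τ).tendsto_sum_nat
  -- … and to `J`: `J − Σ_{m<M} = ∫ rem_M · 2(1 − cos) ∈ [0, 4/l_M + τ²/l_M²]`
  have hF := integrableOn_weilArchDensity_modulation τ
  have hterm : ∀ m : ℕ, ∫ t in Ioi (0 : ℝ), Real.exp (-((2 * m + 1 / 2) * t)) * (2 * (1 - Real.cos (τ * t))) =
      digammaTerm (digammaNode m) τ := fun m ↦ by
    rw [show (fun t : ℝ ↦ Real.exp (-((2 * m + 1 / 2) * t)) * (2 * (1 - Real.cos (τ * t)))) =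
      fun t ↦ Real.exp (-(digammaNode m * t)) * (2 * (1 - Real.cos (τ * t))) from
      funext fun t ↦ by rw [digammaNode], integral_exp_neg_mul_modulation (digammaNode_pos m)]
  have hfint : ∀ m : ℕ, IntegrableOn (fun t : ℝ ↦ Real.exp (-((2 * m + 1 / 2) * t)) *
      (2 * (1 - Real.cos (τ * t)))) (Ioi 0) := fun m ↦ by
    have := integrableOn_exp_neg_mul_modulation (digammaNode_pos m) τ
    exact this.congr_fun (fun t _ ↦ by rw [digammaNode]) measurableSet_Ioi
  -- the remainder integral and its bound
  have hrem : ∀ M : ℕ, J - ∑ m ∈ Finset.range M, digammaTerm (digammaNode m) τ =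
      ∫ t in Ioi (0 : ℝ), weilArchDensityRem M t * (2 * (1 - Real.cos (τ * t))) := by
    intro M
    have hsum : ∫ t in Ioi (0 : ℝ), (∑ m ∈ Finset.range M,
        Real.exp (-((2 * m + 1 / 2) * t)) * (2 * (1 - Real.cos (τ * t)))) =
        ∑ m ∈ Finset.range M, digammaTerm (digammaNode m) τ := by
      rw [integral_finsetSum _ fun m _ ↦ hfint m]
      exact Finset.sum_congr rfl fun m _ ↦ hterm m
    have hsint : IntegrableOn (fun t : ℝ ↦ ∑ m ∈ Finset.range M,
        Real.exp (-((2 * m + 1 / 2) * t)) * (2 * (1 - Real.cos (τ * t)))) (Ioi 0) :=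
      integrable_finsetSum _ fun m _ ↦ hfint m
    rw [← hsum, hJ, ← integral_sub hF hsint]
    refine setIntegral_congr_fun measurableSet_Ioi fun t (ht : 0 < t) ↦ ?_
    rw [weilArchDensity_eq_sum_add_rem ht M, add_mul, Finset.sum_mul]
    ring
  have hbound : ∀ M : ℕ, |J - ∑ m ∈ Finset.range M, digammaTerm (digammaNode m) τ| ≤
      4 / digammaNode M + τ ^ 2 / digammaNode M ^ 2 := by
    intro M
    have hl := digammaNode_pos M
    rw [hrem M]
    -- `0 ≤ rem ≤ e^{-l_M t}(1 + 1/(2t))`, `2(1−cos) ∈ [0, min(4, τ²t²)]`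
    have hRint : IntegrableOn (fun t : ℝ ↦ weilArchDensityRem M t * (2 * (1 - Real.cos (τ * t)))) (Ioi 0) := by
      have h := hF.sub (integrable_finsetSum (Finset.range M) fun m _ ↦ hfint m)
      refine h.congr_fun (fun t (ht : 0 < t) ↦ ?_) measurableSet_Ioi
      simp only [Pi.sub_apply]
      rw [weilArchDensity_eq_sum_add_rem ht M, add_mul, Finset.sum_mul]
      ring
    have hmaj1 : IntegrableOn (fun t : ℝ ↦ Real.exp (-(digammaNode M * t))) (Ioi 0) :=
      (exp_neg_integrableOn_Ioi 0 hl).congr_fun (fun t _ ↦ by simp only [neg_mul]) measurableSet_Ioi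
    have hG2 := Real.integral_rpow_mul_exp_neg_mul_Ioi (a := 2) (r := digammaNode M) two_pos hl
    have hmaj2 : IntegrableOn (fun t : ℝ ↦ t ^ ((2:ℝ) - 1) * Real.exp (-(digammaNode M * t))) (Ioi 0) :=
      Integrable.of_integral_ne_zero (by rw [hG2]; positivity)
    have hmaj : IntegrableOn (fun t : ℝ ↦ 4 * Real.exp (-(digammaNode M * t)) +
        τ ^ 2 * (t ^ ((2:ℝ) - 1) * Real.exp (-(digammaNode M * t)))) (Ioi 0) :=
      (hmaj1.const_mul 4).add (hmaj2.const_mul _)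
    have hval : ∫ t in Ioi (0 : ℝ), (4 * Real.exp (-(digammaNode M * t)) +
        τ ^ 2 * (t ^ ((2:ℝ) - 1) * Real.exp (-(digammaNode M * t)))) =
        4 / digammaNode M + τ ^ 2 / digammaNode M ^ 2 := by
      rw [integral_add (hmaj1.const_mul 4) (hmaj2.const_mul _), integral_const_mul, integral_const_mul,
        integral_real_exp_neg_mul_Ioi hl, hG2, Real.Gamma_two, Real.rpow_two]
      ring
    have hnonneg : 0 ≤ ∫ t in Ioi (0 : ℝ), weilArchDensityRem M t * (2 * (1 - Real.cos (τ * t))) :=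
      setIntegral_nonneg measurableSet_Ioi fun t (ht : 0 < t) ↦
        mul_nonneg (weilArchDensityRem_nonneg ht M) (two_mul_one_sub_cos_mem _).1
    rw [abs_of_nonneg hnonneg, ← hval]
    refine integral_mono_of_nonneg ?_ hmaj ?_
    · exact (ae_restrict_iff' measurableSet_Ioi).2 (Eventually.of_forall fun t (ht : 0 < t) ↦
        mul_nonneg (weilArchDensityRem_nonneg ht M) (two_mul_one_sub_cos_mem _).1)
    · refine (ae_restrict_iff' measurableSet_Ioi).2 (Eventually.of_forall fun t (ht : 0 < t) ↦ ?_)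
      show weilArchDensityRem M t * (2 * (1 - Real.cos (τ * t))) ≤
        4 * Real.exp (-(digammaNode M * t)) + τ ^ 2 * (t ^ ((2:ℝ) - 1) * Real.exp (-(digammaNode M * t)))
      have hr := weilArchDensityRem_le ht M
      have hr0 := weilArchDensityRem_nonneg ht M
      obtain ⟨hc0, hc4⟩ := two_mul_one_sub_cos_mem (τ * t)
      have hcos : 2 * (1 - Real.cos (τ * t)) ≤ τ ^ 2 * t ^ 2 := by
        have := two_mul_one_sub_cos_le_sq (τ * t); nlinarith
      have hE : 0 < Real.exp (-(digammaNode M * t)) := Real.exp_pos _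
      rw [show (2:ℝ) - 1 = 1 by norm_num, Real.rpow_one]
      have hnode : Real.exp (-((2 * (M:ℝ) + 1 / 2) * t)) = Real.exp (-(digammaNode M * t)) := by
        rw [digammaNode]
      rw [hnode] at hr
      -- `rem · c ≤ E(1 + 1/(2t)) c = E c + E c/(2t) ≤ 4E + E τ² t/2 ≤ 4E + τ² t E`
      have h1 : weilArchDensityRem M t * (2 * (1 - Real.cos (τ * t))) ≤
          Real.exp (-(digammaNode M * t)) * (1 + 1 / (2 * t)) * (2 * (1 - Real.cos (τ * t))) :=
        mul_le_mul_of_nonneg_right hr hc0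
      have h2 : Real.exp (-(digammaNode M * t)) * (1 + 1 / (2 * t)) * (2 * (1 - Real.cos (τ * t))) =
          Real.exp (-(digammaNode M * t)) * (2 * (1 - Real.cos (τ * t))) +
            Real.exp (-(digammaNode M * t)) / (2 * t) * (2 * (1 - Real.cos (τ * t))) := by
        field_simp
      have h3 : Real.exp (-(digammaNode M * t)) / (2 * t) * (2 * (1 - Real.cos (τ * t))) ≤
          Real.exp (-(digammaNode M * t)) / (2 * t) * (τ ^ 2 * t ^ 2) :=
        mul_le_mul_of_nonneg_left hcos (by positivity)
      have h4 : Real.exp (-(digammaNode M * t)) / (2 * t) * (τ ^ 2 * t ^ 2) =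
          τ ^ 2 * (t * Real.exp (-(digammaNode M * t))) / 2 := by
        field_simp
      nlinarith [mul_le_mul_of_nonneg_left hc4 hE.le, sq_nonneg τ,
        mul_nonneg (mul_nonneg (sq_nonneg τ) ht.le) hE.le]
  -- the bound tends to `0`, so the partial sums tend to `J`
  have hnode_tendsto : Tendsto (fun M : ℕ ↦ digammaNode M) atTop atTop := by
    refine tendsto_atTop_add_const_right _ _ (Tendsto.const_mul_atTop two_pos ?_)
    exact tendsto_natCast_atTop_atTop
  have hb0 : Tendsto (fun M : ℕ ↦ 4 / digammaNode M + τ ^ 2 / digammaNode M ^ 2) atTop (𝓝 0) := by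
    have h1 : Tendsto (fun M : ℕ ↦ 4 / digammaNode M) atTop (𝓝 0) :=
      tendsto_const_nhds.div_atTop hnode_tendsto
    have h2 : Tendsto (fun M : ℕ ↦ τ ^ 2 / digammaNode M ^ 2) atTop (𝓝 0) :=
      tendsto_const_nhds.div_atTop (hnode_tendsto.atTop_mul_atTop₀ hnode_tendsto |>.congr fun M ↦ by ring)
    simpa using h1.add h2
  have hpartial : Tendsto (fun M : ℕ ↦ ∑ m ∈ Finset.range M, digammaTerm (digammaNode m) τ) atTop (𝓝 J) := by
    rw [tendsto_iff_norm_sub_tendsto_zero]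
    refine squeeze_zero (fun M ↦ norm_nonneg _) (fun M ↦ ?_) hb0
    rw [Real.norm_eq_abs, abs_sub_comm]
    exact hbound M
  exact (tendsto_nhds_unique hpartial hser).symm ▸ rfl

/-! ## The even-parity modulated flat-window inequality in digamma form -/

/-- **Even characters: the rung makes the Fejér-smoothed key weight non-negative at every height.**  For
`χ` mod `q ≠ 1` EVEN, `a > 0`, `τ ∈ ℝ`: `WeilPositivityOnChar χ a ⟹`
`2Σ_{log n<2a}Λ(n)n^{-1/2}(1 − log n/(2a))Re(χ(n)n^{iτ}) + K₀ − [Re ψ(¼ + iτ/2) − Re ψ(¼)]`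
`− (1/a)∫₀^∞ρ₀(t)cos(τt)min(t,2a)dt ≤ log q`. -/
theorem modulatedFlatWindow_le_log_digamma_of_even {q : ℕ} {a : ℝ} (hq : q ≠ 1)
    (χ : DirichletCharacter ℂ q) (hχ : χ.Even) (ha : 0 < a) (hW : WeilPositivityOnChar χ a) (τ : ℝ) :
    2 * (∑ n ∈ weilPrimeIndex a, (Λ n : ℝ) / Real.sqrt n *
          ((1 - Real.log n / (2 * a)) * (χ (n : ZMod q) * cexp (I * (τ * Real.log n : ℝ))).re)) +
        (Real.log (4 * π) + Real.eulerMascheroniConstant +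
          2 * ∫ t in Ioi (0 : ℝ), weilKillingDensityPar 0 t) -
        (reDigammaQuarter τ - reDigammaQuarter 0) -
        1 / a * ∫ t in Ioi (0 : ℝ), weilArchDensity t * (Real.cos (τ * t) * min t (2 * a)) ≤
      Real.log q := by
  have h := modulatedFlatWindow_le_log_of_weilPositivityOnChar hq χ ha hW τ
  rw [charParity_of_even hχ] at h
  simp_rw [weilArchDensityPar_zero_apply] at h
  -- split the arch integral: `∫ρ₀(2(1−cos) + cos·min/a) = [ψ-difference] + (1/a)∫ρ₀ cos·min`
  have hF := integrableOn_weilArchDensity_modulation τ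
  have hG : IntegrableOn (fun t : ℝ ↦ weilArchDensity t * (Real.cos (τ * t) * min t (2 * a))) (Ioi 0) := by
    refine Integrable.mono' (integrableOn_flatWindow_archMajorant) ?_ ?_
    · exact ((measurable_weilArchDensityPar 0).mul ((by fun_prop : Continuous fun t : ℝ ↦
        Real.cos (τ * t) * min t (2 * a)).measurable)).aestronglyMeasurable.congr
        (Eventually.of_forall fun t ↦ by simp only [Pi.mul_apply, weilArchDensityPar_zero_apply])
    · refine (ae_restrict_iff' measurableSet_Ioi).2 (Eventually.of_forall fun t (ht : 0 < t) ↦ ?_)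
      rw [Real.norm_eq_abs, abs_mul, abs_of_pos (weilArchDensity_pos ht), abs_mul]
      have hc := Real.abs_cos_le_one (τ * t)
      have hm : |min t (2 * a)| ≤ t := by rw [abs_of_nonneg (le_min ht.le (by linarith))]; exact min_le_left _ _
      calc weilArchDensity t * (|Real.cos (τ * t)| * |min t (2 * a)|) ≤ weilArchDensity t * (1 * t) :=
            mul_le_mul_of_nonneg_left (mul_le_mul hc hm (abs_nonneg _) zero_le_one) (weilArchDensity_pos ht).le
        _ = t * weilArchDensity t := by ring
        _ ≤ Real.exp (-(1 / 2 * t)) * (1 + 2 * t) / 2 := mul_weilArchDensity_le ht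
  have hsplit : ∫ t in Ioi (0 : ℝ), weilArchDensity t *
      (2 * (1 - Real.cos (τ * t)) + Real.cos (τ * t) * (min t (2 * a) / a)) =
      (reDigammaQuarter τ - reDigammaQuarter 0) +
        1 / a * ∫ t in Ioi (0 : ℝ), weilArchDensity t * (Real.cos (τ * t) * min t (2 * a)) := by
    rw [← integral_weilArchDensity_modulationCost τ, ← integral_const_mul, ← integral_add hF (hG.const_mul _)]
    refine setIntegral_congr_fun measurableSet_Ioi fun t _ ↦ ?_
    field_simp
  rw [hsplit] at h
  linarith

end Summit.Ventures.WeilGRH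

end
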